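import Summits.ABC.ABC.Theses.FeketeScales
import Summits.ABC.ABC.Theses.FermatTwistHeights
import Summits.ABC.ABC.Theorems.FeketeScalesAssembly
import Summits.ABC.ABC.Theorems.FeketeScalesSparseGoodScalesWindow
import Summits.ABC.ABC.Theorems.FeketeScalesSparseGoodScalesMinimalResidue
import Summits.ABC.ABC.Theorems.FeketeScalesSparseGoodScalesRepulsion
import Summits.ABC.ABC.Theorems.FeketeScalesSparseGoodScalesGeometric
import Summits.ABC.ABC.Theorems.FeketeScalesSparseGoodScalesWieferich
import Summits.ABC.ABC.Theorems.FeketeScalesSparseGoodScalesWieferichMass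
import Summits.ABC.ABC.Theorems.FeketeScalesSparseGoodScalesUpperPropagation
import Summits.ABC.ABC.Theorems.FeketeScalesSparseGoodScalesFirstMomentWall
import Summits.ABC.ABC.Theorems.FeketeScalesTargetOfSubPowerSlack
import Summits.ABC.ABC.Theorems.FeketeScalesTargetEffective
import Summits.ABC.ABC.Theorems.FeketeScalesTargetLogicalPosition
import Literature.Barriers.ABC.EpsilonCannotBeDroppedProofs
import HarnessLib


/-!
# Strategist sketch r1 (cstrat-stmt-ABC-2161-r1) — BC2-REDIRECT re-exam of the RESTATED deciding crux
`Summit.ABC.ABC.Theses.FeketeScales.SparseGoodScales` (stmt-ABC-2161, route-ABC-FeketeScales)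

Companion of `STRATEGY-CENSUS.md` Part A.  NO `sorry`, no new number theory beyond two calibration lemmas:
* §P  the candidate PIECES of every decomposition examined (typed verbatim from the tree; shared with the probe files
      `bc/Probes*.lean`, transcript `bc/PROBES-RESULTS.md`);
* §R  the REGRESS LEMMA: for every piece `H` that abc implies and every glue `2160 → H → SGS`, the sibling crux gives
      `H ↔ ABC` — i.e. the "demotion signal" that binned the crux RESTATED regenerates one level down on every
      abc-consequence piece of every split, by three lines of logic and the landed Assembly (`feketeScales_assembly_proof`, item stmt-ABC-2165);
* §D  per-decomposition certificates BY NAME (glue landed / signal re-fires / costume / summit-plus), D1–D12;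
* §C  two calibration lemmas proved here: `ABC → RadicalRepulsion` (so D3's open piece is an abc-consequence too)
      and `SparseGoodScales → SGSAt 1`.
-/

set_option linter.dupNamespace false

namespace Summit.ABC.ABC.Cruxes.SparseGoodScales.StrategistR1

open Literature.NumberTheory.DiophantineGeometry
open Summit.ABC.ABC.Theses.FeketeScales
open Literature.Barriers.ABC

/-! ## Candidate pieces of a decomposition of `SparseGoodScales` (typed verbatim from the tree) -/

/-- H1 · DA∃ — droughts of SOME ratio (= registered stub `stub_droughtsOfSomeRatio`). [folklore] -/
def DAE : Prop :=
  ∀ δ : ℝ, 0 < δ → ∃ Λ : ℝ, 1 < Λ ∧ ∀ N : ℕ, ∃ R : ℕ, N ≤ R ∧ ∀ a b c : ℕ,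
    IsABCTriple a b c → rad a b c ≤ R → (R : ℝ) < ((rad a b c : ℕ) : ℝ) ^ Λ →
      (c : ℝ) ≤ ((rad a b c : ℕ) : ℝ) ^ (1 + δ)

/-- H2 · WGS — windowed good scales (= dead line `Sketch`'s `stub_windowedGoodScales`). [folklore] -/
def WGS : Prop :=
  ∀ δ : ℝ, 0 < δ → ∀ Λ : ℝ, 1 < Λ → ∀ N : ℕ, ∃ R : ℕ, N ≤ R ∧ ∀ a b c : ℕ, IsABCTriple a b c →
    rad a b c ≤ R → (R : ℝ) < ((rad a b c : ℕ) : ℝ) ^ Λ → (c : ℝ) ≤ (R : ℝ) ^ (1 + δ)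

/-- V2 · BQ — bounded quality / polynomial abc (= item stmt-ABC-1724 `PolynomialABC`, `Iff.rfl`). [folklore] -/
def BQ : Prop :=
  ∃ A C : ℝ, ∀ a b c : ℕ, IsABCTriple a b c → (c : ℝ) ≤ C * ((rad a b c : ℕ) : ℝ) ^ A

/-- H3 · RadicalRepulsion — pairwise repulsion of `(1+δ)`-exceptional radicals. [folklore] -/
def RadicalRepulsion : Prop :=
  ∀ δ : ℝ, 0 < δ → ∃ κ : ℝ, 0 < κ ∧ ∃ r₀ : ℕ, ∀ a b c a' b' c' : ℕ,
    IsABCTriple a b c → IsABCTriple a' b' c' →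
    ((rad a b c : ℕ) : ℝ) ^ (1 + δ) < c → ((rad a' b' c' : ℕ) : ℝ) ^ (1 + δ) < c' →
    r₀ ≤ rad a b c → rad a b c < rad a' b' c' →
    ((rad a b c : ℕ) : ℝ) ^ (1 + κ) ≤ ((rad a' b' c' : ℕ) : ℝ)

/-- T1 · Floor — infinitely many non-Wieferich primes to every prime base (Silverman's abc-consequence). [cite: Silverman1988, Thm 1] -/
def Floor : Prop :=
  ∀ q : ℕ, q.Prime → {p : ℕ | p.Prime ∧ ¬ IsWieferich q p}.Infinite

/-- B1 · FloorBridge — "the crux modulo Wieferich" (bridge half of split D4). [folklore] -/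
def FloorBridge : Prop := Floor → SparseGoodScales

/-- H4 · CountingThreshold — `O_δ(log log X)` exceptional radicals below `X`. [folklore] -/
def CountingThreshold : Prop :=
  ∀ δ : ℝ, 0 < δ → ∃ C : ℝ, ∀ X : ℕ, 3 ≤ X →
    (({r : ℕ | r ≤ X ∧ ∃ a b c : ℕ, IsABCTriple a b c ∧ rad a b c = r ∧
        ((r : ℕ) : ℝ) ^ (1 + δ) < c}).ncard : ℝ) ≤ C * Real.log (Real.log X)

/-- S1 · DoublingLaw — two-scale growth law `G(R²) ≤ R^{1+δ} G(R)`, G-free. [folklore] -/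
def DoublingLaw : Prop :=
  ∀ δ : ℝ, 0 < δ → ∃ R₀ : ℕ, ∀ R : ℕ, R₀ ≤ R → ∀ a b c : ℕ, IsABCTriple a b c →
    rad a b c ≤ R * R → ∃ a' b' c' : ℕ, IsABCTriple a' b' c' ∧ rad a' b' c' ≤ R ∧
      (c : ℝ) ≤ (R : ℝ) ^ (1 + δ) * c'

/-- C1 · GoodPowersOfTwo — named scales (a COSTUME: `↔` the crux, landed p109286). [folklore] -/
def GoodPowersOfTwo : Prop :=
  ∀ δ : ℝ, 0 < δ → ∀ N : ℕ, ∃ j : ℕ, N ≤ j ∧ ∀ a b c : ℕ, IsABCTriple a b c →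
    rad a b c ≤ 2 ^ j → (c : ℝ) ≤ ((2 ^ j : ℕ) : ℝ) ^ (1 + δ)

/-- E1 · ESGS — EFFECTIVE sparse good scales (every window `[N, N²]` beyond `exp(C δ^{-B})`). [folklore] -/
def ESGS : Prop :=
  ∃ B C : ℝ, ∀ δ : ℝ, 0 < δ → δ ≤ 1 → ∀ N : ℕ, Real.exp (C * δ ^ (-B)) ≤ (N : ℝ) →
    ∃ R : ℕ, N ≤ R ∧ R ≤ N ^ 2 ∧
      ∀ a b c : ℕ, IsABCTriple a b c → rad a b c ≤ R → (c : ℝ) ≤ (R : ℝ) ^ (1 + δ)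

/-- I1 · SGSAt δ — ONE instance of the crux (fixed exponent `1+δ`). [folklore] -/
def SGSAt (δ : ℝ) : Prop :=
  ∀ N : ℕ, ∃ R : ℕ, N ≤ R ∧ ∀ a b c : ℕ, IsABCTriple a b c → rad a b c ≤ R →
    (c : ℝ) ≤ (R : ℝ) ^ (1 + δ)

/-- B2 · DeltaBootstrap — "one instance improves to all δ" (bridge half of the δ-split D8). [folklore] -/
def DeltaBootstrap : Prop := SGSAt 1 → SparseGoodScales

/-- V3 · SubPower — pointwise sub-power slack (hypothesis of the proved `SubmultOfRST`; RST-A-upper-type). [folklore] -/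
def SubPower : Prop :=
  ∃ τ : ℝ, τ < 1 ∧ ∃ A : ℝ, ∀ a b c : ℕ, IsABCTriple a b c →
    (c : ℝ) < ((rad a b c : ℕ) : ℝ) * Real.exp (A * Real.log ((rad a b c : ℕ) : ℝ) ^ τ)

/-- B3 · Bridge2160 — the Wiles-shape bridge at ROUTE level: "scale sub-multiplicativity implies abc". [folklore] -/
def Bridge2160 : Prop := ScaleSubmultiplicativity → _root_.ABC

/-- B4 · WeakToSGS — "exponent-2 abc bootstraps to the liminf shadow" (bridge half of split D11). [folklore] -/
def WeakToSGS : Prop := WeakABCConjecture → SparseGoodScales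


open Summit.ABC.ABC.Theorems
open Summit.ABC.ABC.Theorems.SparseGoodScales

/-! ## §R The regress lemma -/

/-- REGRESS (pure logic). In any route whose deciding theorem consumes `V` and `X`, a piece `H` of a split
`V ∧ H ⟹ X` that the Statement implies is Statement-EQUIVALENT given `V`.  This is the exact shape of the
signal `2160 → (SparseGoodScales ↔ ABC)` that binned the crux, and of Ribet's theorem in
`FLT ⇐ Modularity ∧ (Modularity → FLT)` (given Modularity, `(Modularity → FLT) ↔ FLT`). [folklore] -/
theorem regress {V H X S : Prop} (glue : V → H → X) (closes : V → X → S) (cons : S → H) (hV : V) :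
    H ↔ S :=
  ⟨fun hH => closes hV (glue hV hH), cons⟩

/-- REGRESS IN ROUTE FeketeScales: every abc-consequence `H` glued to the crux through the sibling crux
`ScaleSubmultiplicativity` is abc-equivalent given that sibling (Assembly = `feketeScales_assembly_proof`,
stmt-ABC-2165, landed). [folklore] -/
theorem regress_inRoute (H : Prop) (glue : ScaleSubmultiplicativity → H → SparseGoodScales)
    (cons : _root_.ABC → H) (hS : ScaleSubmultiplicativity) : H ↔ _root_.ABC :=
  regress glue (fun hS' hX => feketeScales_assembly_proof hS' hX) cons hS

/-- REGRESS FOR AN ARBITRARY SPLIT `Rest ∧ H ⟹ SGS` inside the route: as long as the other leaves `Rest` of the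
ROUTE still contain the sibling crux (they always do: `closes` consumes it), the abc-consequence leaf `H` is
abc-equivalent given `Rest`.  So NO decomposition of `SparseGoodScales` with an abc-consequence piece escapes
the signal. [folklore] -/
theorem regress_anySplit {Rest H : Prop} (assembly : Rest → H → SparseGoodScales)
    (sibling : Rest → ScaleSubmultiplicativity) (cons : _root_.ABC → H) (hR : Rest) : H ↔ _root_.ABC :=
  ⟨fun hH => feketeScales_assembly_proof (sibling hR) (assembly hR hH), cons⟩

/-- The same for a BRIDGE piece `T → X` (Wiles shape inside the crux): given the sibling and `T`, the bridge
is abc-equivalent — and `ABC → (T → X)` holds for every `T` (`sparseGoodScales_of_abc`). [folklore] -/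
theorem regress_bridge (T : Prop) (hS : ScaleSubmultiplicativity) (hT : T) :
    (T → SparseGoodScales) ↔ _root_.ABC :=
  ⟨fun b => feketeScales_assembly_proof hS (b hT), fun habc _ => sparseGoodScales_of_abc habc⟩

/-! ## §C Calibration lemmas proved here -/

/-- `SparseGoodScales → SGSAt 1` (an instance is weaker than the crux; the δ-split D8 is `SGSAt 1 ∧ DeltaBootstrap`). [folklore] -/
theorem sgsAt_one_of_sgs (h : SparseGoodScales) : SGSAt 1 := fun N => h 1 one_pos N

/-- **`ABC → RadicalRepulsion`**: under abc the `(1+δ)`-exceptional triples have bounded radical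
(`rad^{δ/2} < C(δ/2)`), so beyond `r₀ := ⌈C^{2/δ}⌉₊ + 2` the repulsion hypothesis is vacuous.  Hence D3's
open piece is an abc-consequence and carries the regress signal as well. [folklore] -/
theorem radicalRepulsion_of_abc (habc : _root_.ABC) : RadicalRepulsion := by
  intro δ hδ
  obtain ⟨C, hC, h⟩ := (_root_.ABC_iff.mp habc) (δ / 2) (by linarith)
  refine ⟨1, one_pos, ⌈C ^ (2 / δ)⌉₊ + 2, ?_⟩
  intro a b c a' b' c' habc' _ hexc _ hr₀ _
  exfalso
  have hlt := h a b c habc'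
  set r : ℝ := ((rad a b c : ℕ) : ℝ) with hr
  have hr₀' : ((⌈C ^ (2 / δ)⌉₊ + 2 : ℕ) : ℝ) ≤ r := by rw [hr]; exact_mod_cast hr₀
  have hceil : C ^ (2 / δ) ≤ ((⌈C ^ (2 / δ)⌉₊ : ℕ) : ℝ) := Nat.le_ceil _
  have hrC : C ^ (2 / δ) < r := by push_cast at hr₀'; linarith
  have hrpos : 0 < r := lt_of_le_of_lt (Real.rpow_nonneg hC.le _) hrC
  have hCr : C < r ^ (δ / 2) := by
    have h1 : (C ^ (2 / δ)) ^ (δ / 2) < r ^ (δ / 2) :=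
      Real.rpow_lt_rpow (Real.rpow_nonneg hC.le _) hrC (by linarith)
    have h2 : (C ^ (2 / δ)) ^ (δ / 2) = C := by
      rw [← Real.rpow_mul hC.le]
      have : 2 / δ * (δ / 2) = 1 := by field_simp
      rw [this, Real.rpow_one]
    linarith [h1, h2]
  have hkey : C * r ^ (1 + δ / 2) < r ^ (1 + δ) := by
    have hpow : 0 < r ^ (1 + δ / 2) := Real.rpow_pos_of_pos hrpos _
    calc C * r ^ (1 + δ / 2) < r ^ (δ / 2) * r ^ (1 + δ / 2) := mul_lt_mul_of_pos_right hCr hpow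
      _ = r ^ (1 + δ) := by rw [← Real.rpow_add hrpos]; ring_nf
  linarith [hexc, hlt, hkey]

/-! ## §D Per-decomposition certificates (every decl used on the right is LANDED; see census Part A table) -/

/-- D1 glue `2160 ∧ DA∃ ⟹ SGS` — landed p111037 (criterion (b) ✓, non-trivial seam). [folklore] -/
theorem d1_glue : ScaleSubmultiplicativity → DAE → SparseGoodScales :=
  fun h₁ h₂ => sparseGoodScales_of_scaleSubmultiplicativity_of_droughts h₁ h₂

/-- D1 signal one level down, from the regress lemma alone. [folklore] -/
theorem d1_signal (hS : ScaleSubmultiplicativity) : DAE ↔ _root_.ABC :=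
  regress_inRoute DAE d1_glue (fun h => droughtsOfSomeRatio_of_abc h) hS

/-- D1 signal, as ALREADY LANDED in Theorems (p111037) — what the re-audit would cite. [folklore] -/
theorem d1_signal_landed (hS : ScaleSubmultiplicativity) : DAE ↔ _root_.ABC :=
  droughtsOfSomeRatio_iff_abc_of_scaleSubmultiplicativity hS

/-- D2 glue `BQ ∧ WGS ⟹ SGS` — landed p96117. [folklore] -/
theorem d2_glue : BQ → WGS → SparseGoodScales :=
  fun h₁ h₂ => sparseGoodScales_of_boundedQuality_of_windowed h₁ h₂

/-- D2: in-route BQ is supplied by the sibling (p96477), so WGS carries the signal (landed p96477 as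
`sparseGoodScales_windowed_iff_abc_of_scaleSubmultiplicativity`; here from the regress lemma). [folklore] -/
theorem d2_signal (hS : ScaleSubmultiplicativity) : WGS ↔ _root_.ABC :=
  regress_inRoute WGS
    (fun hS' hW => d2_glue (sparseGoodScales_boundedQuality_of_scaleSubmultiplicativity hS') hW)
    (fun h => sparseGoodScales_windowed_of_abc h) hS

/-- D3 glue `2160 ∧ RadicalRepulsion ⟹ SGS` — landed p107129 ∘ p111037. [folklore] -/
theorem d3_glue : ScaleSubmultiplicativity → RadicalRepulsion → SparseGoodScales :=
  fun h₁ h₂ => sparseGoodScales_of_scaleSubmultiplicativity_of_droughts h₁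
    (droughtsOfSomeRatio_of_radicalRepulsion h₂)

/-- D3 signal (new: uses `radicalRepulsion_of_abc` of §C). [folklore] -/
theorem d3_signal (hS : ScaleSubmultiplicativity) : RadicalRepulsion ↔ _root_.ABC :=
  regress_inRoute RadicalRepulsion d3_glue radicalRepulsion_of_abc hS

/-- D4 glue `Floor ∧ (Floor → SGS) ⟹ SGS` — modus ponens (`trivial_seam`), and TIGHT: `SGS → Floor` (p99695). [folklore] -/
theorem d4_glue : Floor → FloorBridge → SparseGoodScales := fun h f => f h

/-- D4 tightness. [folklore] -/
theorem d4_tight : SparseGoodScales → Floor := fun h q hq => sparseGoodScales_imp_infinite_not_isWieferich h q hq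

/-- D4: the bridge half is an abc-consequence for free and abc-equivalent given sibling + Floor. [folklore] -/
theorem d4_signal (hS : ScaleSubmultiplicativity) (hF : Floor) : FloorBridge ↔ _root_.ABC :=
  regress_bridge Floor hS hF

/-- D8 (δ-split) glue `SGSAt 1 ∧ DeltaBootstrap ⟹ SGS` — modus ponens. [folklore] -/
theorem d8_glue : SGSAt 1 → DeltaBootstrap → SparseGoodScales := fun h f => f h

/-- D8: the bootstrap half is abc-equivalent given sibling + the instance. [folklore] -/
theorem d8_signal (hS : ScaleSubmultiplicativity) (h1 : SGSAt 1) : DeltaBootstrap ↔ _root_.ABC :=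
  regress_bridge (SGSAt 1) hS h1

/-- D9 NAMED SCALES is a costume: `↔` the crux (landed p109286) — fails (c) "no landed iff". [folklore] -/
theorem d9_costume : SparseGoodScales ↔ GoodPowersOfTwo := sparseGoodScales_iff_goodPowersOfTwo

/-- D10 EFFECTIVE sparse good scales give the crux ALONE (landed) — a strengthening, `k = 1`, fails (a)/(c). [folklore] -/
theorem d10_alone : ESGS → SparseGoodScales := fun h => Target.sparseGoodScales_of_effectiveSparseGoodScales h

/-- D11 (exponent-2 split) glue `WeakABC ∧ (WeakABC → SGS) ⟹ SGS` — modus ponens; bridge half abc-equivalent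
given sibling + WeakABC. [folklore] -/
theorem d11_signal (hS : ScaleSubmultiplicativity) (hW : WeakABCConjecture) : WeakToSGS ↔ _root_.ABC :=
  regress_bridge WeakABCConjecture hS hW

/-- D12 the Wiles shape AT ROUTE LEVEL: `Bridge2160 := (2160 → ABC)` is exactly "the crux given the sibling",
i.e. `Bridge2160 ↔ (2160 → SGS)`. [folklore] -/
theorem d12_bridge_iff : Bridge2160 ↔ (ScaleSubmultiplicativity → SparseGoodScales) :=
  ⟨fun b hS => sparseGoodScales_of_abc (b hS), fun f hS => feketeScales_assembly_proof hS (f hS)⟩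

/-- D12: and it carries the same conditional signal, trivially. [folklore] -/
theorem d12_signal (hS : ScaleSubmultiplicativity) : Bridge2160 ↔ _root_.ABC :=
  ⟨fun b => b hS, fun h _ => h⟩

/-- abc-FREE pieces are summit-PLUS (fail (c) by a landed `C → S`): SubPower (p-Target files) … [folklore] -/
theorem subPower_gives_S : SubPower → _root_.ABC := fun h => Target.abc_of_subPowerSlack h

/-- … and Robert–Stewart–Tenenbaum A (upper half). [folklore] -/
theorem rstUpper_gives_S : RSTConjectureAUpper → _root_.ABC := fun h => _root_.ABC_iff.mpr (RSTConjectureAUpper.imp_abc h)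

/-- The trigger itself, for the record (landed p96477). [folklore] -/
theorem trigger (hS : ScaleSubmultiplicativity) : SparseGoodScales ↔ _root_.ABC :=
  sparseGoodScales_iff_abc_of_scaleSubmultiplicativity hS

end Summit.ABC.ABC.Cruxes.SparseGoodScales.StrategistR1
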